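import Literature.MathematicalPhysics.KineticTheory.ReyBelletThomas2002Hormander
import Literature.Analysis.Distribution.BracketSpanRescale
import HarnessLib

/-!
# Rey-Bellet–Thomas 2002: invariant measures of the effective dynamics have smooth densities (from Hörmander's theorem)

Topic `Literature/MathematicalPhysics/KineticTheory` (trunk T-KINETIC). Provefact unit for the
named fact `ReyBelletThomas2002_thm21` (`ReyBelletThomas2002.lean`, Rey-Bellet–Thomas 2002,
Theorem 2.1), third PROVED ingredient: the part "`μ` has a `C^∞` … density" of Theorem 2.1 for
EVERY invariant finite measure `μ` of EVERY Markov semigroup with generator `L` (13) on `C_c^∞`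
(the interface `MarkovSemigroupFor (P.rbGenerator Λ N T_L T_R)`), CONDITIONALLY on Hörmander's
hypoellipticity theorem (named fact `Literature.Analysis.Distribution.Hormander1967_thm11`), by the
printed route §4: "If the Lie algebra generated by … has rank dim(X) at every point then the Markov
process has a `C^∞` law … This is a consequence of Hörmander Theorem [11, 16]", with
Proposition 4.1 (`isBracketGenerating_rbHormanderFamily`, PROVED in
`ReyBelletThomas2002Hormander.lean`) supplying the rank condition.

* `MarkovSemigroupFor.IsInvariant.integral_generator_eq_zero` — **invariant finite measures are
  weakly stationary**, for the generic interface: `∫ L f dμ = 0` for `f ∈ C_c^∞` with `L f` bounded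
  measurable (integrate Dynkin's identity `P_1 f - f = ∫₀¹ P_s(Lf) ds` against `μ`; Fubini).
* `OscillatorChain.continuous_rbGenerator`, `hasCompactSupport_rbGenerator`,
  `exists_bound_rbGenerator` — `L f ∈ C_c` for `f ∈ C²_c` and `C¹` potentials.
* `OscillatorChain.fieldDiv_rbDrift` — `div X₀ = -2γ`; `OscillatorChain.rbAdjointFamily` — the
  family `(-X₀, X_L, X_R)` of the Fokker–Planck operator `L* = X_L² + X_R² - X₀ + 2γ`;
  `hormanderTranspose_eq_rbGenerator` — `ᵗ(L*) f = L f`; `isBracketGenerating_rbAdjointFamily` —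
  the bracket condition for `L*` (from Prop. 4.1 by sign-invariance, `BracketSpanRescale.lean`).
* `ReyBelletThomas2002_smoothDensity_of_hormander` — **Hörmander's Theorem 1.1 ⇒ every invariant
  finite measure of a Markov semigroup with generator `L` has a `C^∞` density**, for smooth `U, V`
  with `V` satisfying H2, `Λ ≠ 0`, `γ, T_L, T_R > 0`, any `N`.

Positivity of the density and uniqueness of the invariant measure (the remaining clauses of
Theorem 2.1 about `μ`) need the support theorem / irreducibility (RBT Prop. 4.2) and are not
addressed here.

## References

* L. Rey-Bellet, L. E. Thomas, Comm. Math. Phys. **225** (2002) 305–329 (arXiv:math-ph/0110024),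
  §2 eq. (13), Thm 2.1, §4 (rank condition (45), Prop. 4.1).
* L. Hörmander, Acta Math. **119** (1967) 147–171, Thm 1.1.
-/

noncomputable section

open MeasureTheory ProbabilityTheory Set Filter Finset Literature.Analysis.Distribution
open scoped ContDiff NNReal ENNReal Topology

namespace Literature.MathematicalPhysics.KineticTheory.HeatConduction

/-! ### Invariant finite measures of a `MarkovSemigroupFor L` are weakly stationary -/

namespace MarkovSemigroupFor

variable {X : Type*} [MeasurableSpace X] [NormedAddCommGroup X] [NormedSpace ℝ X]
  {L : (X → ℝ) → X → ℝ} (S : MarkovSemigroupFor L)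

/-- `P_t g` is bounded by any bound of `g` (the kernels are probability measures). [folklore] -/
theorem norm_act_le (t : ℝ≥0) {g : X → ℝ} {C : ℝ} (hC : ∀ x, ‖g x‖ ≤ C) (z : X) :
    ‖S.act t g z‖ ≤ C := by
  rw [act_apply]
  calc ‖∫ y, g y ∂(S.kernel t z)‖ ≤ C * (S.kernel t z).real Set.univ :=
        norm_integral_le_of_norm_le_const (Eventually.of_forall hC)
    _ = C := by simp

/-- `P_t g` is strongly measurable for strongly measurable `g`. [folklore] -/
theorem stronglyMeasurable_act (t : ℝ≥0) {g : X → ℝ} (hg : StronglyMeasurable g) :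
    StronglyMeasurable (S.act t g) :=
  hg.integral_kernel (κ := S.kernel t)

/-- Joint measurability of `(z, s) ↦ P_s g (z)`. [folklore] -/
theorem stronglyMeasurable_uncurry_act {g : X → ℝ} (hg : StronglyMeasurable g) :
    StronglyMeasurable fun p : X × ℝ => S.act p.2.toNNReal g p.1 := by
  let K : Kernel (ℝ≥0 × X) X := ⟨fun p => S.kernel p.1 p.2, S.measurable_kernel⟩
  have h1 : StronglyMeasurable fun p : ℝ≥0 × X => ∫ y, g y ∂(K p) :=
    hg.integral_kernel (κ := K)
  exact h1.comp_measurable ((measurable_snd.real_toNNReal).prodMk measurable_fst)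

/-- **Invariance in integrated form**: `∫ P_t g dμ = ∫ g dμ` for an invariant measure `μ` and
`g ∈ L¹(μ)`. [folklore] -/
theorem IsInvariant.integral_act {μ : Measure X} (hμ : S.IsInvariant μ) (t : ℝ≥0) {g : X → ℝ}
    (hg : Integrable g μ) : ∫ z, S.act t g z ∂μ = ∫ z, g z ∂μ := by
  have hint : Integrable g ((S.kernel t ∘ₖ Kernel.const Unit μ) ()) := by
    rw [← Measure.comp_eq_comp_const_apply, (hμ t).def]
    exact hg
  calc ∫ z, S.act t g z ∂μ
      = ∫ z, ∫ y, g y ∂(S.kernel t z) ∂(Kernel.const Unit μ ()) := by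
        rw [Kernel.const_apply]; rfl
    _ = ∫ y, g y ∂((S.kernel t ∘ₖ Kernel.const Unit μ) ()) := (Kernel.integral_comp hint).symm
    _ = ∫ y, g y ∂μ := by rw [← Measure.comp_eq_comp_const_apply, (hμ t).def]

/-- **Invariant finite measures are weakly stationary.** If `μ` is a finite invariant measure of
a Markov semigroup with generator `L` on `C_c^∞` and `f ∈ C_c^∞` has `L f` bounded and strongly
measurable, then `∫ L f dμ = 0`: integrate Dynkin's identity `P_1 f - f = ∫₀¹ P_s(Lf) ds`
against `μ` and use invariance on both sides (Fubini on the right). [folklore] -/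
theorem IsInvariant.integral_generator_eq_zero [OpensMeasurableSpace X] {μ : Measure X}
    [IsFiniteMeasure μ] (hμ : S.IsInvariant μ) {f : X → ℝ} (hf : ContDiff ℝ ∞ f)
    (hfc : HasCompactSupport f) (hLm : StronglyMeasurable (L f)) (hLb : ∃ C, ∀ x, ‖L f x‖ ≤ C) :
    ∫ x, L f x ∂μ = 0 := by
  set g := L f with hg_def
  obtain ⟨C, hC⟩ := hLb
  have hg_int : Integrable g μ :=
    (integrable_const C).mono' hLm.aestronglyMeasurable (Eventually.of_forall hC)
  obtain ⟨Cf, hCf⟩ := hf.continuous.bounded_above_of_compact_support hfc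
  have hfsm : StronglyMeasurable f := hf.continuous.stronglyMeasurable
  have hf_int : Integrable f μ :=
    (integrable_const Cf).mono' hfsm.aestronglyMeasurable (Eventually.of_forall hCf)
  have hPf_int : Integrable (S.act 1 f) μ :=
    (integrable_const Cf).mono' (S.stronglyMeasurable_act 1 hfsm).aestronglyMeasurable
      (Eventually.of_forall (S.norm_act_le 1 hCf))
  set ν : Measure ℝ := volume.restrict (Set.Ioc 0 1) with hν
  have hGint : Integrable (Function.uncurry fun (z : X) (s : ℝ) => S.act s.toNNReal g z)
      (μ.prod ν) :=
    (integrable_const C).mono' (S.stronglyMeasurable_uncurry_act hLm).aestronglyMeasurable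
      (Eventually.of_forall fun p => S.norm_act_le _ hC _)
  have hD : ∀ z, S.act 1 f z - f z = ∫ s in (0:ℝ)..1, S.act s.toNNReal g z := by
    intro z
    have h := S.act_sub_self f hf hfc 1 z
    simpa using h
  have hlhs : ∫ z, (S.act 1 f z - f z) ∂μ = 0 := by
    rw [integral_sub hPf_int hf_int, hμ.integral_act S 1 hf_int, sub_self]
  have hrhs : ∫ z, (∫ s in (0:ℝ)..1, S.act s.toNNReal g z) ∂μ = ∫ z, g z ∂μ := by
    simp_rw [intervalIntegral.integral_of_le zero_le_one]
    rw [← hν, integral_integral_swap hGint]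
    have h : ∀ s : ℝ, ∫ z, S.act s.toNNReal g z ∂μ = ∫ z, g z ∂μ := fun s =>
      hμ.integral_act S _ hg_int
    simp_rw [h]
    rw [integral_const, measureReal_restrict_apply_univ, Real.volume_real_Ioc_of_le zero_le_one,
      sub_zero, one_smul]
  calc ∫ x, g x ∂μ = ∫ z, (∫ s in (0:ℝ)..1, S.act s.toNNReal g z) ∂μ := hrhs.symm
    _ = ∫ z, (S.act 1 f z - f z) ∂μ := integral_congr_ae (Eventually.of_forall fun z =>
        (hD z).symm)
    _ = 0 := hlhs

end MarkovSemigroupFor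

/-! ### `L f ∈ C_c` for `f ∈ C²_c` -/

variable {N : ℕ}

/-- `∂_{r_L} f` is continuous for `f ∈ C¹`. [folklore] -/
theorem continuous_partialRL {f : RBPhaseSpace N → ℝ} {n : WithTop ℕ∞} (hf : ContDiff ℝ n f)
    (hn : n ≠ 0) : Continuous (partialRL f) := by
  rw [partialRL_eq_lineDeriv]; exact continuous_lineDeriv_apply hf hn _

/-- `∂_{r_R} f` is continuous for `f ∈ C¹`. [folklore] -/
theorem continuous_partialRR {f : RBPhaseSpace N → ℝ} {n : WithTop ℕ∞} (hf : ContDiff ℝ n f)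
    (hn : n ≠ 0) : Continuous (partialRR f) := by
  rw [partialRR_eq_lineDeriv]; exact continuous_lineDeriv_apply hf hn _

/-- `∂_{r_L} f ∈ C^m` for `f ∈ C^{m+1}`. [folklore] -/
theorem contDiff_partialRL {f : RBPhaseSpace N → ℝ} {m n : WithTop ℕ∞} (hf : ContDiff ℝ n f)
    (hmn : m + 1 ≤ n) : ContDiff ℝ m (partialRL f) := by
  rw [partialRL_eq_lineDeriv]; exact contDiff_lineDeriv_apply hf hmn _

/-- `∂_{r_R} f ∈ C^m` for `f ∈ C^{m+1}`. [folklore] -/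
theorem contDiff_partialRR {f : RBPhaseSpace N → ℝ} {m n : WithTop ℕ∞} (hf : ContDiff ℝ n f)
    (hmn : m + 1 ≤ n) : ContDiff ℝ m (partialRR f) := by
  rw [partialRR_eq_lineDeriv]; exact contDiff_lineDeriv_apply hf hmn _

/-- `∂_{q_i} f` (extended phase space) is continuous for `f ∈ C¹`. [folklore] -/
theorem continuous_rbPartialQ {f : RBPhaseSpace N → ℝ} {n : WithTop ℕ∞} (hf : ContDiff ℝ n f)
    (hn : n ≠ 0) (i : Fin N) : Continuous (rbPartialQ i f) := by
  rw [rbPartialQ_eq_lineDeriv]; exact continuous_lineDeriv_apply hf hn _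

/-- `∂_{p_i} f` (extended phase space) is continuous for `f ∈ C¹`. [folklore] -/
theorem continuous_rbPartialP {f : RBPhaseSpace N → ℝ} {n : WithTop ℕ∞} (hf : ContDiff ℝ n f)
    (hn : n ≠ 0) (i : Fin N) : Continuous (rbPartialP i f) := by
  rw [rbPartialP_eq_lineDeriv]; exact continuous_lineDeriv_apply hf hn _

/-- Compact support is inherited by `∂_{r_L} f`. [folklore] -/
theorem hasCompactSupport_partialRL {f : RBPhaseSpace N → ℝ} (hf : Differentiable ℝ f)
    (hfc : HasCompactSupport f) : HasCompactSupport (partialRL f) := by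
  rw [partialRL_eq_lineDeriv]; exact hasCompactSupport_lineDeriv_apply hf hfc _

/-- Compact support is inherited by `∂_{r_R} f`. [folklore] -/
theorem hasCompactSupport_partialRR {f : RBPhaseSpace N → ℝ} (hf : Differentiable ℝ f)
    (hfc : HasCompactSupport f) : HasCompactSupport (partialRR f) := by
  rw [partialRR_eq_lineDeriv]; exact hasCompactSupport_lineDeriv_apply hf hfc _

/-- Compact support is inherited by `∂_{q_i} f`. [folklore] -/
theorem hasCompactSupport_rbPartialQ {f : RBPhaseSpace N → ℝ} (hf : Differentiable ℝ f)
    (hfc : HasCompactSupport f) (i : Fin N) : HasCompactSupport (rbPartialQ i f) := by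
  rw [rbPartialQ_eq_lineDeriv]; exact hasCompactSupport_lineDeriv_apply hf hfc _

/-- Compact support is inherited by `∂_{p_i} f`. [folklore] -/
theorem hasCompactSupport_rbPartialP {f : RBPhaseSpace N → ℝ} (hf : Differentiable ℝ f)
    (hfc : HasCompactSupport f) (i : Fin N) : HasCompactSupport (rbPartialP i f) := by
  rw [rbPartialP_eq_lineDeriv]; exact hasCompactSupport_lineDeriv_apply hf hfc _

/-! ### Constant vector fields and their transposes -/

/-- `ᵗX f = -X f` for a constant vector field `X ≡ v` on the extended phase space. [folklore] -/
theorem fieldTranspose_constField (v : RBPhaseSpace N) (f : RBPhaseSpace N → ℝ)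
    (x : RBPhaseSpace N) : fieldTranspose (fun _ => v) f x = -fderiv ℝ f x v := by
  simp [fieldTranspose, fieldDeriv, fieldDiv]

/-- `ᵗX (ᵗX f) = X (X f)` for a constant field (its transpose is `-X`). [folklore] -/
theorem fieldTranspose_fieldTranspose_constField (v : RBPhaseSpace N) {f : RBPhaseSpace N → ℝ}
    (x : RBPhaseSpace N) :
    fieldTranspose (fun _ => v) (fieldTranspose (fun _ => v) f) x =
      fieldDeriv (fun _ => v) (fieldDeriv (fun _ => v) f) x := by
  have h1 : fieldTranspose (fun _ : RBPhaseSpace N => v) f = fun y => -fieldDeriv (fun _ => v) f y := by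
    funext y; rw [fieldTranspose_constField]; rfl
  rw [fieldTranspose_constField, h1, fderiv_fun_neg]
  simp [fieldDeriv]

namespace OscillatorChain

variable (P : OscillatorChain)

/-- For `C¹` potentials and `f ∈ C²`, `L f` is continuous. [folklore] -/
theorem continuous_rbGenerator (hU : ContDiff ℝ 1 P.U) (hV : ContDiff ℝ 1 P.V) (Λ : ℝ) (N : ℕ)
    (T_L T_R : ℝ) {f : RBPhaseSpace N → ℝ} (hf : ContDiff ℝ 2 f) :
    Continuous (P.rbGenerator Λ N T_L T_R f) := by
  have hH : ContDiff ℝ 1 (P.hamiltonian N) := P.contDiff_hamiltonian hU hV N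
  have h2 : (2 : WithTop ℕ∞) ≠ 0 := by norm_num
  have hq : ∀ i : Fin N, Continuous (rbPartialQ i f) := fun i => continuous_rbPartialQ hf h2 i
  have hp : ∀ i : Fin N, Continuous (rbPartialP i f) := fun i => continuous_rbPartialP hf h2 i
  have hL1 : ContDiff ℝ 1 (partialRL f) := contDiff_partialRL hf (by norm_num)
  have hR1 : ContDiff ℝ 1 (partialRR f) := contDiff_partialRR hf (by norm_num)
  have hL : Continuous (partialRL f) := hL1.continuous
  have hR : Continuous (partialRR f) := hR1.continuous
  have hLL : Continuous (partialRL (partialRL f)) := continuous_partialRL hL1 one_ne_zero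
  have hRR : Continuous (partialRR (partialRR f)) := continuous_partialRR hR1 one_ne_zero
  have hqH : ∀ i : Fin N, Continuous fun x : RBPhaseSpace N => partialQ i (P.hamiltonian N) x.1 :=
    fun i => (P.continuous_partialQ_hamiltonian hH i).comp continuous_fst
  have hx2 : ∀ i : Fin N, Continuous fun x : RBPhaseSpace N => x.1.2 i := fun i => by fun_prop
  have hrL : Continuous fun x : RBPhaseSpace N => x.2.1 := by fun_prop
  have hrR : Continuous fun x : RBPhaseSpace N => x.2.2 := by fun_prop
  unfold rbGenerator
  refine Continuous.add (Continuous.add (continuous_finsetSum _ fun i _ =>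
    ((hx2 i).mul (hq i)).sub ((hqH i).mul (hp i))) (continuous_const.mul
      (((continuous_const.mul hLL).sub (hrL.mul hL)).add
        ((continuous_const.mul hRR).sub (hrR.mul hR)))))
    (continuous_const.mul (continuous_finsetSum _ fun i _ => Continuous.add ?_ ?_))
  · by_cases h : i.val = 0
    · simp only [h, if_true]
      exact ((hx2 i).mul hL).sub (hrL.mul (hp i))
    · simp only [h, if_false]
      exact continuous_const
  · by_cases h : i.val = N - 1
    · simp only [h, if_true]
      exact ((hx2 i).mul hR).sub (hrR.mul (hp i))
    · simp only [h, if_false]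
      exact continuous_const

/-- For `f ∈ C²_c`, `L f` has compact support (every term carries a derivative of `f`).
[folklore] -/
theorem hasCompactSupport_rbGenerator (Λ : ℝ) (N : ℕ) (T_L T_R : ℝ) {f : RBPhaseSpace N → ℝ}
    (hf : ContDiff ℝ 2 f) (hfc : HasCompactSupport f) :
    HasCompactSupport (P.rbGenerator Λ N T_L T_R f) := by
  have hd : Differentiable ℝ f := hf.differentiable (by norm_num)
  have hL1 : ContDiff ℝ 1 (partialRL f) := contDiff_partialRL hf (by norm_num)
  have hR1 : ContDiff ℝ 1 (partialRR f) := contDiff_partialRR hf (by norm_num)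
  have hq : ∀ i : Fin N, HasCompactSupport (rbPartialQ i f) := fun i =>
    hasCompactSupport_rbPartialQ hd hfc i
  have hp : ∀ i : Fin N, HasCompactSupport (rbPartialP i f) := fun i =>
    hasCompactSupport_rbPartialP hd hfc i
  have hL : HasCompactSupport (partialRL f) := hasCompactSupport_partialRL hd hfc
  have hR : HasCompactSupport (partialRR f) := hasCompactSupport_partialRR hd hfc
  have hLL : HasCompactSupport (partialRL (partialRL f)) :=
    hasCompactSupport_partialRL (hL1.differentiable one_ne_zero) hL
  have hRR : HasCompactSupport (partialRR (partialRR f)) :=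
    hasCompactSupport_partialRR (hR1.differentiable one_ne_zero) hR
  simp only [hasCompactSupport_iff_eventuallyEq] at hq hp hL hR hLL hRR ⊢
  have hq' : ∀ᶠ x in coclosedCompact (RBPhaseSpace N), ∀ i, rbPartialQ i f x = 0 :=
    eventually_all.mpr fun i => (hq i).mono fun x hx => hx
  have hp' : ∀ᶠ x in coclosedCompact (RBPhaseSpace N), ∀ i, rbPartialP i f x = 0 :=
    eventually_all.mpr fun i => (hp i).mono fun x hx => hx
  filter_upwards [hq', hp', hL, hR, hLL, hRR] with x hxq hxp hxL hxR hxLL hxRR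
  simp [rbGenerator, hxq, hxp, hxL, hxR, hxLL, hxRR]

/-- For `C¹` potentials and `f ∈ C²_c`, `L f` is bounded. [folklore] -/
theorem exists_bound_rbGenerator (hU : ContDiff ℝ 1 P.U) (hV : ContDiff ℝ 1 P.V) (Λ : ℝ) (N : ℕ)
    (T_L T_R : ℝ) {f : RBPhaseSpace N → ℝ} (hf : ContDiff ℝ 2 f) (hfc : HasCompactSupport f) :
    ∃ C, ∀ x, ‖P.rbGenerator Λ N T_L T_R f x‖ ≤ C :=
  (P.continuous_rbGenerator hU hV Λ N T_L T_R hf).bounded_above_of_compact_support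
    (P.hasCompactSupport_rbGenerator Λ N T_L T_R hf hfc)

/-- **Invariant finite measures of a Markov semigroup with generator `L` (13) are weakly
stationary**: `∫ L f dμ = 0` for all `f ∈ C_c^∞` (`C¹` potentials). [cite: ReyBelletThomas2002, §2 eq. (13)] -/
theorem integral_rbGenerator_eq_zero_of_isInvariant (hU : ContDiff ℝ 1 P.U) (hV : ContDiff ℝ 1 P.V)
    {Λ : ℝ} {N : ℕ} {T_L T_R : ℝ} (S : MarkovSemigroupFor (P.rbGenerator Λ N T_L T_R))
    {μ : Measure (RBPhaseSpace N)} [IsFiniteMeasure μ] (hμ : S.IsInvariant μ)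
    {f : RBPhaseSpace N → ℝ} (hf : ContDiff ℝ ∞ f) (hfc : HasCompactSupport f) :
    ∫ x, P.rbGenerator Λ N T_L T_R f x ∂μ = 0 := by
  have hf2 : ContDiff ℝ 2 f := hf.of_le (by norm_cast)
  exact hμ.integral_generator_eq_zero S hf hfc
    (P.continuous_rbGenerator hU hV Λ N T_L T_R hf2).stronglyMeasurable
    (P.exists_bound_rbGenerator hU hV Λ N T_L T_R hf2 hfc)

/-! ### The Fokker–Planck operator `L*` in Hörmander's form -/

section Adjoint

variable (hU : ContDiff ℝ ∞ P.U) (hV : ContDiff ℝ ∞ P.V) (Λ : ℝ) (N : ℕ)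
include hU hV

/-- **The divergence of the drift** is the constant `-2γ` (only the reservoir friction terms
`-γ r_b ∂_{r_b}` contribute to `tr DX₀`). [folklore] -/
theorem fieldDiv_rbDrift (x : RBPhaseSpace N) : fieldDiv (P.rbDrift Λ N) x = -(2 * P.γ) := by
  unfold fieldDiv
  classical
  let b := ((Pi.basisFun ℝ (Fin N)).prod (Pi.basisFun ℝ (Fin N))).prod
    ((Module.Basis.singleton Unit ℝ).prod (Module.Basis.singleton Unit ℝ))
  rw [LinearMap.trace_eq_matrix_trace ℝ b, Matrix.trace]
  simp only [Matrix.diag_apply, LinearMap.toMatrix_apply, ContinuousLinearMap.coe_coe,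
    Fintype.sum_sum_type, b, Module.Basis.prod_repr_inl, Module.Basis.prod_repr_inr,
    Pi.basisFun_repr, Module.Basis.prod_apply, Pi.basisFun_apply, Sum.elim_inl, Sum.elim_inr,
    LinearMap.coe_inl, LinearMap.coe_inr, Function.comp_apply, Module.Basis.singleton_apply,
    Module.Basis.singleton_repr, Finset.univ_unique, Finset.sum_singleton]
  have hQ : ∀ i : Fin N, ((Pi.single i (1 : ℝ), (0 : Fin N → ℝ)), (0 : ℝ × ℝ)) =
      (rbUnitQ i : RBPhaseSpace N) := fun i => rfl
  have hP : ∀ i : Fin N, (((0 : Fin N → ℝ), Pi.single i (1 : ℝ)), (0 : ℝ × ℝ)) =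
      (rbUnitP i : RBPhaseSpace N) := fun i => rfl
  have hL : (((0 : (Fin N → ℝ) × (Fin N → ℝ)), ((1 : ℝ), (0 : ℝ))) : RBPhaseSpace N) = rbUnitRL :=
    rfl
  have hR : (((0 : (Fin N → ℝ) × (Fin N → ℝ)), ((0 : ℝ), (1 : ℝ))) : RBPhaseSpace N) = rbUnitRR :=
    rfl
  simp only [hQ, hP, hL, hR, P.fderiv_rbDrift_rbUnitQ hU hV, P.fderiv_rbDrift_rbUnitP hU hV,
    P.fderiv_rbDrift_rbUnitRL hU hV, P.fderiv_rbDrift_rbUnitRR hU hV]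
  simp only [Pi.zero_apply, Finset.sum_const_zero, zero_add]
  ring

/-- The family `(-X₀, X_L, X_R)` of the Fokker–Planck operator `L* = X_L² + X_R² - X₀ + 2γ` (the
formal adjoint of `L = X_L² + X_R² + X₀`, `div X₀ = -2γ`), indexed by `Option (Fin 2)`.
[cite: ReyBelletThomas2002, §4 eq. (45)] -/
def rbAdjointFamily (Λ : ℝ) (N : ℕ) (T_L T_R : ℝ) :
    Option (Fin 2) → RBPhaseSpace N → RBPhaseSpace N :=
  fun o => o.elim (fun y => -P.rbDrift Λ N y) (P.rbBathField T_L T_R)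

omit hU hV in
/-- The adjoint family is the generator's family with the drift's sign flipped. [folklore] -/
theorem rbAdjointFamily_eq_smul (T_L T_R : ℝ) (o : Option (Fin 2)) :
    P.rbAdjointFamily Λ N T_L T_R o =
      (Option.elim o (-1 : ℝ) fun _ => 1) • P.rbHormanderFamily Λ N T_L T_R o := by
  cases o with
  | none => funext y; simp [rbAdjointFamily, rbHormanderFamily]
  | some b => funext y; simp [rbAdjointFamily, rbHormanderFamily]

/-- **The bracket condition for `L*`** (from Prop. 4.1 and sign-invariance).
[cite: ReyBelletThomas2002, Prop 4.1] -/
theorem isBracketGenerating_rbAdjointFamily {T_L T_R : ℝ} (hV2 : RBNondegenerate P.V)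
    (hΛ : Λ ≠ 0) (hL : 0 < P.γ * T_L) (hR : 0 < P.γ * T_R) :
    IsBracketGenerating (P.rbAdjointFamily Λ N T_L T_R) univ :=
  (isBracketGenerating_iff_of_eq_smul (P.contDiff_rbHormanderFamily hU hV Λ N T_L T_R)
    (P.rbAdjointFamily_eq_smul Λ N T_L T_R) (fun o => by cases o <;> simp) univ).2
    (P.isBracketGenerating_rbHormanderFamily hU hV hV2 hΛ hL hR)

/-- **`ᵗ(L*) = L`**: with `X₀' = -X₀`, `X_b = √(γT_b) ∂_{r_b}` and `c = 2γ`, the operator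
`P = ∑_b X_b² + X₀' + c = L*` of Hörmander's form (1.6) satisfies `ᵗP f = L f` for smooth `f`
(`γT_L, γT_R ≥ 0`); so a weakly stationary measure, `∫ L f dμ = 0`, is a distributional solution
of `L* μ = 0`. [cite: ReyBelletThomas2002, §2 eq. (13)] -/
theorem hormanderTranspose_eq_rbGenerator {T_L T_R : ℝ} (hL : 0 ≤ P.γ * T_L)
    (hR : 0 ≤ P.γ * T_R) {f : RBPhaseSpace N → ℝ} (hf : ContDiff ℝ ∞ f) :
    hormanderTranspose (fun y => -P.rbDrift Λ N y) (P.rbBathField (N := N) T_L T_R)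
      (fun _ => 2 * P.γ) f = P.rbGenerator Λ N T_L T_R f := by
  funext x
  rw [P.rbGenerator_eq_hormanderOp Λ hL hR hf x, hormanderTranspose, hormanderOp]
  have hb : ∀ b : Fin 2, fieldTranspose (P.rbBathField (N := N) T_L T_R b)
      (fieldTranspose (P.rbBathField (N := N) T_L T_R b) f) x =
      fieldDeriv (P.rbBathField (N := N) T_L T_R b)
        (fieldDeriv (P.rbBathField (N := N) T_L T_R b) f) x := fun b =>
    fieldTranspose_fieldTranspose_constField _ x
  have h0 : fieldTranspose (fun y => -P.rbDrift Λ N y) f x =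
      fieldDeriv (P.rbDrift Λ N) f x - 2 * P.γ * f x := by
    have e1 : fieldDiv (fun y => -P.rbDrift Λ N y) x = 2 * P.γ := by
      rw [fieldDiv, fderiv_fun_neg]
      simp only [ContinuousLinearMap.toLinearMap_neg, map_neg]
      rw [show LinearMap.trace ℝ _ (fderiv ℝ (P.rbDrift Λ N) x : RBPhaseSpace N →ₗ[ℝ] RBPhaseSpace N)
        = fieldDiv (P.rbDrift Λ N) x from rfl, P.fieldDiv_rbDrift hU hV Λ N]
      ring
    rw [fieldTranspose, fieldDeriv, fieldDeriv, e1, map_neg]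
    ring
  rw [Finset.sum_congr rfl fun b _ => hb b, h0]
  ring

end Adjoint

end OscillatorChain

/-! ### Smooth densities of invariant measures, from Hörmander's theorem -/

/-- **Rey-Bellet–Thomas 2002, Thm 2.1 (the clause "`μ` has a `C^∞` density"), from Hörmander's
Theorem 1.1, for every invariant finite measure.** For smooth potentials `U, V` with `V`
satisfying **H2**, coupling `Λ ≠ 0`, `γ > 0` and temperatures `T_L, T_R > 0`, let `S` be any Markov
semigroup on the extended phase space with generator `L` (13) on `C_c^∞`
(`MarkovSemigroupFor (P.rbGenerator Λ N T_L T_R)`) and `μ` a finite invariant measure of `S`.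
Then `∫ L f dμ = 0` for `f ∈ C_c^∞` (Dynkin + invariance), i.e. `L* μ = 0` in `𝓓'` with
`L* = X_L² + X_R² - X₀ + 2γ` of Hörmander's form (`hormanderTranspose_eq_rbGenerator`), whose family
satisfies the bracket condition everywhere (Prop. 4.1); Hörmander's theorem makes `μ` a smooth
function: `μ = g · Leb` with `g ∈ C^∞`, `g ≥ 0`. [cite: ReyBelletThomas2002, Thm 2.1]
[cite: Hormander1967, Thm 1.1] -/
theorem ReyBelletThomas2002_smoothDensity_of_hormander (hH : Hormander1967_thm11)
    {P : OscillatorChain} (hU : ContDiff ℝ ∞ P.U) (hV : ContDiff ℝ ∞ P.V)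
    (hV2 : RBNondegenerate P.V) (hγ : 0 < P.γ) {Λ : ℝ} (hΛ : Λ ≠ 0) {N : ℕ} {T_L T_R : ℝ}
    (hL : 0 < T_L) (hR : 0 < T_R) (S : MarkovSemigroupFor (P.rbGenerator Λ N T_L T_R))
    {μ : Measure (RBPhaseSpace N)} [IsFiniteMeasure μ] (hμ : S.IsInvariant μ) :
    ∃ g : RBPhaseSpace N → ℝ, ContDiff ℝ ∞ g ∧ (∀ x, 0 ≤ g x) ∧
      μ = (volume : Measure (RBPhaseSpace N)).withDensity fun x => ENNReal.ofReal (g x) := by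
  haveI := isAddHaarMeasure_volume_rbPhaseSpace N
  have hγL : 0 < P.γ * T_L := mul_pos hγ hL
  have hγR : 0 < P.γ * T_R := mul_pos hγ hR
  exact hH.exists_eq_withDensity (volume : Measure (RBPhaseSpace N))
    (X₀ := fun y => -P.rbDrift Λ N y) (X := P.rbBathField T_L T_R) (c := fun _ => 2 * P.γ)
    (P.contDiff_rbDrift hU hV Λ N).neg (fun _ => contDiff_const) contDiff_const
    (P.isBracketGenerating_rbAdjointFamily hU hV Λ N hV2 hΛ hγL hγR) μ
    (fun φ hφ hφc => by
      rw [P.hormanderTranspose_eq_rbGenerator hU hV Λ N hγL.le hγR.le hφ]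
      exact P.integral_rbGenerator_eq_zero_of_isInvariant (hU.of_le (by exact_mod_cast le_top))
        (hV.of_le (by exact_mod_cast le_top)) S hμ hφ hφc)

end Literature.MathematicalPhysics.KineticTheory.HeatConduction
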